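import Literature.AlgebraicGeometry.ShimuraVarieties.UnitaryShimuraComplexRecordSystem
import Literature.NumberTheory.Transcendental.AnalytificationFunctorialityProofs
import HarnessLib

/-!
# Deligne's record system = an `L`-descent, with reciprocity, of a complex record system

Topic `AlgebraicGeometry/ShimuraVarieties`; namespace `Literature.AlgebraicGeometry.ShimuraVarieties`, grouping sub-namespace
`UnitaryCanonicalModel`.  THEOREMS ONLY (no definition, no named fact; T5: n/a).

[Deligne1979ShimuraVarieties] 2.2.5 (PDF p. 29 L16–28 of Milne's translation `paper:url-7710442a1cf6`): «A canonical model
`M(G,X)` of `M_ℂ(G,X)` is a form over `E(G,X)` of `M_ℂ(G,X)` … such that … (b) … the Galois group … acts through the action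
2.2.4.  By "form" we mean a scheme `M` over `E(G,X)` equipped with … an equivariant isomorphism `M ⊗_{E(G,X)} ℂ ⥲ M_ℂ(G,X)`».
Read on the tree's carriers this is EXACTLY the decomposition

  `RecordSystem L H τ T hT K₀`  =  (a complex record system `Sc`, [Del79] 2.1.2–2.1.4: `UnitaryShimuraComplexRecordSystem`)
                                  + (an `L`-DESCENT of `Sc`: smooth projective `L`-schemes `M_K`, functorial in `K ≤ K₀`, with an
                                     isomorphism of functors `M ⊗_{L,τ} ℂ ≅ Sc.Mc` — the «form» —, on whose complex points
                                     `Aut(ℂ/τL)` satisfies (62) at the diagonal special pairs — clause (b)),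

and this file proves it in the kernel:

* `RecordSystem.nonempty_of_descent` — a complex record system `Sc`, `L`-models `M` with `e : M ⋙ (· ⊗_{L,τ} ℂ) ≅ Sc.Mc` and
  reciprocity (62) (stated on the points `(baseChangeEquiv τ M_K)⁻¹ (e⁻¹ (Sc.pts_K⁻¹ [x, aK]))`) GIVE a `RecordSystem` (the
  clauses `pts`/`map_pts`/`hol`/`pieces` are transported along `e`: points by `AlgPoints.map e.inv` — a homeomorphism —,
  holomorphy by `AlgPoints.evalOrZero_map` and `IsAffineOpen.preimage_of_isIso`, the pieces cofan by `IsColimit.ofIsoColimit`);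
* `RecordSystem.descent_self` — conversely a record system is the descent of its own shadow `S.complexRecordSystem` along
  the identity;
* **`exists_recordSystem_iff_descent`** — the named fact `exists_recordSystem` ([Del79] 2.2.5 + Cor. 2.7.21 on the tree's
  carriers) is EQUIVALENT to: «at every datum, SOME complex record system admits an `L`-descent with reciprocity».  Since complex
  record systems EXIST at every datum with no named fact (Summits-side `HComp.nonempty_complexRecordSystem`, cell pub-hodgecm2)
  and are unique up to `pts`-compatible isomorphism (`ComplexRecord.nonempty_iso`), the content of the cite is the descent
  clause alone.

HC_CM is not mentioned and not implied; no binder of any cell is discharged here.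

## References
* [Deligne1979ShimuraVarieties] P. Deligne, *Variétés de Shimura* (1979), 2.1.2–2.1.4 (PDF pp. 23–24), 2.2.4–2.2.5 (PDF p. 29),
  Cor. 2.7.21 (PDF p. 52) of Milne's translation `paper:url-7710442a1cf6`.
* [Milne2005ShimuraVarieties] J. S. Milne, *Introduction to Shimura varieties* (2005/2017), Def. 12.8 (62) p. 114, Def. 12.10 p. 115.
-/

set_option autoImplicit false

noncomputable section

open Function MulAction Topology NumberField IsDedekindDomain CategoryTheory CategoryTheory.Limits Matrix
  AlgebraicGeometry
open scoped Matrix ComplexOrder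
open Literature.AlgebraicGeometry.Motives
open Literature.NumberTheory.Automorphic Literature.NumberTheory.Automorphic.UnitaryGroup
open Literature.NumberTheory.Automorphic.Liu2021.AppendixC (C5.OpenCompactSubgroup C5.SmallLevel)
open Literature.Geometry.ComplexHyperbolic Literature.Geometry.ComplexHyperbolic.BallModel
open Literature.NumberTheory.Automorphic.ShimuraDissection

namespace Literature.AlgebraicGeometry.ShimuraVarieties

namespace UnitaryCanonicalModel

variable {L : Type} [Field L] [NumberField L] [IsCMField L] {H : Matrix (Fin 3) (Fin 3) L}
  {τ : L →+* ℂ} {T : GL (Fin 3) ℂ} {hT : formCongr (starRingEnd ℂ) T (H.map τ) = BallModel.J}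
  {K₀ : C5.OpenCompactSubgroup ↥(finAdelic (↥(maximalRealSubfield L)) L (IsCMField.complexConj L) 3 H)}

omit [NumberField L] [IsCMField L] in
/-- Naturality of `X_τ(ℂ) → X(ℂ)` (`AlgPoints.baseChangeEquiv`, inverse direction) in the `L`-scheme `X` (as in
`UnitaryShimuraComplexRecordSystem`). [folklore] -/
private theorem baseChangeEquiv_symm_map' {X Y : SchemeOver L} (f : X ⟶ Y)
    (u : ComplexPoints ((Motives.baseChangeHom τ).obj X)) :
    (letI : Algebra L ℂ := τ.toAlgebra
     (AlgPoints.baseChangeEquiv τ Y).symm (AlgPoints.map ((Motives.baseChangeHom τ).map f) u) =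
      AlgPoints.map f ((AlgPoints.baseChangeEquiv τ X).symm u)) := by
  letI : Algebra L ℂ := τ.toAlgebra
  apply Over.OverMorphism.ext
  rw [AlgPoints.baseChangeEquiv_symm_apply_left, AlgPoints.map_apply, Over.comp_left,
    AlgPoints.map_apply, Over.comp_left, AlgPoints.baseChangeEquiv_symm_apply_left]
  simp only [Category.assoc, Motives.baseChangeHom_map_left_comp_fst]
  exact (Category.assoc _ _ _).symm

/-! ### §1. A descent datum gives a record system -/

set_option maxHeartbeats 1600000 in -- large adelic / Shimura-set terms: instance-heavy statement and transport
/-- **An `L`-descent with reciprocity of a complex record system is a record system** ([Deligne1979ShimuraVarieties] 2.2.5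
«a form over `E(G,X)` of `M_ℂ(G,X)` … equipped with … an equivariant isomorphism … (b) the Galois group acts through 2.2.4»): given
a complex record system `Sc` below `K₀`, smooth projective `L`-schemes `M_K` functorial in `K ≤ K₀`, an isomorphism of functors
`e : M ⋙ (· ⊗_{L,τ} ℂ) ≅ Sc.Mc`, and Shimura reciprocity (62) at the diagonal special pairs for the `Aut(ℂ/τL)`-action on
`M_K(ℂ)` read through `e` and `Sc.pts`, the data assemble into a `RecordSystem L H τ T hT K₀` — the complex clauses `pts`,
`map_pts`, `hol`, `pieces` being TRANSPORTED from `Sc` along `e` (points: `AlgPoints.map e⁻¹`, a homeomorphism; holomorphy: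
`AlgPoints.evalOrZero_map` on the affine open `e⁻¹U`, `IsAffineOpen.preimage_of_isIso`; pieces: the cofan composed with `e⁻¹`).
[cite: Deligne1979ShimuraVarieties, 2.2.4–2.2.5 (PDF p. 29 of Milne's translation)] [cite: Milne2005ShimuraVarieties, Def. 12.8 (62) p. 114; Def. 12.10 p. 115] -/
theorem RecordSystem.nonempty_of_descent (Sc : ComplexRecordSystem L H τ T hT K₀)
    (M : C5.SmallLevel K₀ ⥤ SchemeOver L)
    (hsm : ∀ K : C5.SmallLevel K₀, AlgebraicGeometry.SmoothOfRelativeDimension 2 (M.obj K).hom)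
    (hpr : ∀ K : C5.SmallLevel K₀, IsProjectiveOver (M.obj K))
    (e : (M ⋙ Motives.baseChangeHom τ) ≅ Sc.Mc)
    (recip : letI : Algebra L ℂ := τ.toAlgebra
      ∀ (K : C5.SmallLevel K₀) (σ : ℂ ≃ₐ[L] ℂ) (s : (FiniteAdeleRing (𝓞 L) L)ˣ),
        IsArtinCorrespondent L τ s σ.toRingEquiv →
        ∀ (v₃ : Fin 3 → L) (x : Ball), IsLinePoint L τ T v₃ x →
          ∀ d : finAdelic (↥(maximalRealSubfield L)) L (IsCMField.complexConj L) 3 H,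
            IsDiagTwist L H v₃ (recipFactor L s) d →
            ∀ a : finAdelic (↥(maximalRealSubfield L)) L (IsCMField.complexConj L) 3 H,
              σ • (AlgPoints.baseChangeEquiv τ (M.obj K)).symm
                  (AlgPoints.map (e.inv.app K) ((Sc.pts K).symm (ShimuraSet.mk L H τ T hT K.1.1 x a))) =
                (AlgPoints.baseChangeEquiv τ (M.obj K)).symm
                  (AlgPoints.map (e.inv.app K) ((Sc.pts K).symm (ShimuraSet.mk L H τ T hT K.1.1 x (d * a))))) :
    Nonempty (RecordSystem L H τ T hT K₀) := by
  letI : Algebra L ℂ := τ.toAlgebra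
  classical
  -- the components of `e`, typed on `(M_K)_τ`
  let eK : ∀ K : C5.SmallLevel K₀, (Motives.baseChangeHom τ).obj (M.obj K) ≅ Sc.Mc.obj K := fun K => e.app K
  have heK_nat : ∀ (K K' : C5.SmallLevel K₀) (f : K ⟶ K'),
      (Motives.baseChangeHom τ).map (M.map f) ≫ (eK K').hom = (eK K).hom ≫ Sc.Mc.map f :=
    fun K K' f => e.hom.naturality f
  haveI hiso : ∀ K : C5.SmallLevel K₀, IsIso (eK K).inv.left := fun K =>
    (inferInstance : IsIso ((Over.forget _).mapIso (eK K)).inv)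
  -- `M_K(ℂ)_{along τ} ≃ₜ (M_K)_τ(ℂ) ≃ₜ Mc_K(ℂ) ≃ₜ Sh_K(ℂ)`
  let b : ∀ K : C5.SmallLevel K₀, ComplexPoints (M.obj K) ≃ₜ ComplexPoints ((Motives.baseChangeHom τ).obj (M.obj K)) :=
    fun K => Homeomorph.mk (AlgPoints.baseChangeEquiv τ (M.obj K)) (AlgPoints.continuous_baseChangeEquiv τ (M.obj K))
      (AlgPoints.continuous_baseChangeEquiv_symm τ (M.obj K))
  -- the homeomorphism of complex points induced by the isomorphism `eK K` (`AlgPoints.map` both ways)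
  let ptsH : ∀ K : C5.SmallLevel K₀, ComplexPoints ((Motives.baseChangeHom τ).obj (M.obj K)) ≃ₜ ComplexPoints (Sc.Mc.obj K) :=
    fun K => Homeomorph.mk ⟨AlgPoints.map (eK K).hom, AlgPoints.map (eK K).inv,
        fun P => by rw [← AlgPoints.map_comp_apply, Iso.hom_inv_id, AlgPoints.map_id]; rfl,
        fun Q => by rw [← AlgPoints.map_comp_apply, Iso.inv_hom_id, AlgPoints.map_id]; rfl⟩
      (AlgPoints.continuous_map _) (AlgPoints.continuous_map _)
  let pts : ∀ K : C5.SmallLevel K₀, ComplexPoints (M.obj K) ≃ₜ ShimuraSet L H τ T hT K.1.1 :=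
    fun K => ((b K).trans (ptsH K)).trans (Sc.pts K)
  have hpts : ∀ (K : C5.SmallLevel K₀) (P : ShimuraSet L H τ T hT K.1.1),
      (pts K).symm P = (AlgPoints.baseChangeEquiv τ (M.obj K)).symm (AlgPoints.map (eK K).inv ((Sc.pts K).symm P)) :=
    fun K P => rfl
  have hpts' : ∀ (K : C5.SmallLevel K₀) (P : ShimuraSet L H τ T hT K.1.1),
      AlgPoints.baseChangeEquiv τ (M.obj K) ((pts K).symm P) = AlgPoints.map (eK K).inv ((Sc.pts K).symm P) :=
    fun K P => by rw [hpts, Equiv.apply_symm_apply]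
  have hinvhom : ∀ (K : C5.SmallLevel K₀) (P : ComplexPoints (Sc.Mc.obj K)),
      AlgPoints.map (eK K).hom (AlgPoints.map (eK K).inv P) = P := fun K P => by
    rw [← AlgPoints.map_comp_apply, Iso.inv_hom_id, AlgPoints.map_id]; rfl
  refine ⟨{ M := M, smooth := hsm, projective := hpr, pts := pts, map_pts := ?_, hol := ?_, pieces := ?_, recip := ?_ }⟩
  · -- transitions: naturality of `e` and `Sc.map_pts`
    intro K K' f z a
    change Sc.pts K' (AlgPoints.map (eK K').hom (AlgPoints.baseChangeEquiv τ (M.obj K')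
      (AlgPoints.map (M.map f) ((pts K).symm (ShimuraSet.mk L H τ T hT K.1.1 z a))))) = _
    have h1 : AlgPoints.baseChangeEquiv τ (M.obj K')
          (AlgPoints.map (M.map f) ((pts K).symm (ShimuraSet.mk L H τ T hT K.1.1 z a))) =
        AlgPoints.map ((Motives.baseChangeHom τ).map (M.map f))
          (AlgPoints.baseChangeEquiv τ (M.obj K) ((pts K).symm (ShimuraSet.mk L H τ T hT K.1.1 z a))) := by
      apply (AlgPoints.baseChangeEquiv τ (M.obj K')).symm.injective
      rw [Equiv.symm_apply_apply, baseChangeEquiv_symm_map', Equiv.symm_apply_apply]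
    have h2 : ∀ Q : ComplexPoints ((Motives.baseChangeHom τ).obj (M.obj K)),
        AlgPoints.map (eK K').hom (AlgPoints.map ((Motives.baseChangeHom τ).map (M.map f)) Q) =
          AlgPoints.map (Sc.Mc.map f) (AlgPoints.map (eK K).hom Q) := fun Q => by
      rw [← AlgPoints.map_comp_apply, heK_nat K K' f, AlgPoints.map_comp_apply]
    rw [h1, h2, hpts', hinvhom]
    exact Sc.map_pts K K' f z a
  · -- holomorphy, transported along `e⁻¹`
    intro K a
    obtain ⟨u, hu1, hu2, hu3⟩ := Sc.hol K a
    refine ⟨fun v => AlgPoints.map (eK K).inv (u v), fun x => ?_, fun v hv c hc => ?_, fun U f => ?_⟩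
    · change AlgPoints.map (eK K).inv (u ((T : Matrix (Fin 3) (Fin 3) ℂ) *ᵥ BallModel.lift x)) = _
      rw [hu1 x, hpts']
    · change AlgPoints.map (eK K).inv (u (c • v)) = AlgPoints.map (eK K).inv (u v)
      rw [hu2 v hv c hc]
    · have hU : IsAffineOpen ((eK K).inv.left ⁻¹ᵁ (↑U : ((Motives.baseChangeHom τ).obj (M.obj K)).left.Opens)) :=
        U.2.preimage_of_isIso (eK K).inv.left
      have hd := hu3 ⟨_, hU⟩ ((eK K).inv.left.app (↑U : ((Motives.baseChangeHom τ).obj (M.obj K)).left.Opens) f)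
      refine (hd.congr ?_).mono ?_
      · rintro v -
        exact AlgPoints.evalOrZero_map (eK K).inv _ f (u v)
      · rintro v ⟨hv, hvU⟩
        exact ⟨hv, hvU⟩
  · -- pieces: the cofan of `Sc` composed with `e⁻¹`
    intro K
    obtain ⟨g, hg, X, ι, hcol, B, hB⟩ := Sc.pieces K
    refine ⟨g, hg, X, fun q => ι q ≫ (eK K).inv, ?_, B, fun q => ⟨(hB q).1, (hB q).2.1, fun x => ?_⟩⟩
    · exact IsColimit.ofIsoColimit hcol (Cofan.ext (eK K).symm fun q => rfl)
    · rw [AlgPoints.map_comp_apply, (hB q).2.2 x, hpts']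
  · -- reciprocity: the hypothesis, read through `pts`
    intro K σ s hσ v₃ x hx d hd a
    rw [hpts, hpts]
    exact recip K σ s hσ v₃ x hx d hd a

/-! ### §2. A record system is the descent of its own shadow -/

/-- **Every record system is the descent of its complex shadow along the identity**: the data of
`RecordSystem.nonempty_of_descent` for `Sc := S.complexRecordSystem`, `M := S.M`, `e := Iso.refl`, with the reciprocity
hypothesis being (F3) `S.recip` verbatim. [cite: Deligne1979ShimuraVarieties, 2.2.5 (PDF p. 29 of Milne's translation)] -/
theorem RecordSystem.descent_self (S : RecordSystem L H τ T hT K₀) :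
    letI : Algebra L ℂ := τ.toAlgebra
    ∀ (K : C5.SmallLevel K₀) (σ : ℂ ≃ₐ[L] ℂ) (s : (FiniteAdeleRing (𝓞 L) L)ˣ),
      IsArtinCorrespondent L τ s σ.toRingEquiv →
      ∀ (v₃ : Fin 3 → L) (x : Ball), IsLinePoint L τ T v₃ x →
        ∀ d : finAdelic (↥(maximalRealSubfield L)) L (IsCMField.complexConj L) 3 H,
          IsDiagTwist L H v₃ (recipFactor L s) d →
          ∀ a : finAdelic (↥(maximalRealSubfield L)) L (IsCMField.complexConj L) 3 H,
            σ • (AlgPoints.baseChangeEquiv τ (S.M.obj K)).symm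
                (AlgPoints.map ((Iso.refl (S.M ⋙ Motives.baseChangeHom τ)).inv.app K)
                  ((S.complexRecordSystem.pts K).symm (ShimuraSet.mk L H τ T hT K.1.1 x a))) =
              (AlgPoints.baseChangeEquiv τ (S.M.obj K)).symm
                (AlgPoints.map ((Iso.refl (S.M ⋙ Motives.baseChangeHom τ)).inv.app K)
                  ((S.complexRecordSystem.pts K).symm (ShimuraSet.mk L H τ T hT K.1.1 x (d * a)))) := by
  letI : Algebra L ℂ := τ.toAlgebra
  intro K σ s hσ v₃ x hx d hd a
  have h : ∀ P : ShimuraSet L H τ T hT K.1.1, (AlgPoints.baseChangeEquiv τ (S.M.obj K)).symm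
      (AlgPoints.map ((Iso.refl (S.M ⋙ Motives.baseChangeHom τ)).inv.app K)
        ((S.complexRecordSystem.pts K).symm P)) = (S.pts K).symm P := by
    intro P
    change (AlgPoints.baseChangeEquiv τ (S.M.obj K)).symm (AlgPoints.map (𝟙 _)
      (AlgPoints.baseChangeEquiv τ (S.M.obj K) ((S.pts K).symm P))) = _
    rw [AlgPoints.map_id]
    exact Equiv.symm_apply_apply _ _
  rw [h, h]
  exact S.recip K σ s hσ v₃ x hx d hd a

/-! ### §3. The named fact as a descent statement -/

/-- **`exists_recordSystem` ⟺ «some complex record system descends to `L` with reciprocity»** — [Deligne1979ShimuraVarieties]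
2.2.5 + Cor. 2.7.21 on the tree's carriers, SPLIT into its complex-geometric part (a `ComplexRecordSystem`, 2.1.2–2.1.4:
constructible at every datum with no named fact — Summits-side `HComp.nonempty_complexRecordSystem` — and unique up to
`pts`-compatible isomorphism, `ComplexRecord.nonempty_iso`) and its ARITHMETIC part (the `L`-form `e : M ⊗_{L,τ} ℂ ≅ Sc.Mc` of
smooth projective `L`-schemes functorial in the level, with (62) at the diagonal special pairs).  `→`: `descent_self`;
`←`: `nonempty_of_descent`. [cite: Deligne1979ShimuraVarieties, 2.2.5 and Cor. 2.7.21 (PDF pp. 29, 52 of Milne's translation)]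
[cite: Milne2005ShimuraVarieties, Def. 12.8 (62) p. 114; Def. 12.10 p. 115] -/
theorem exists_recordSystem_iff_descent :
    exists_recordSystem ↔
      ∀ (L : Type) [Field L] [NumberField L] [IsCMField L] (H : Matrix (Fin 3) (Fin 3) L) (τ : L →+* ℂ)
        (T : GL (Fin 3) ℂ) (hT : formCongr (starRingEnd ℂ) T (H.map τ) = BallModel.J),
        (∀ τ' : L →+* ℂ, InfinitePlace.mk τ' ≠ InfinitePlace.mk τ → (H.map τ').PosDef) →
        (∀ v : Fin 3 → L, hermForm (cmConjRingHom L) H v v = 0 → v = 0) →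
        ∀ K₀ : C5.OpenCompactSubgroup ↥(finAdelic (↥(maximalRealSubfield L)) L (IsCMField.complexConj L) 3 H),
          (∀ g : finAdelic (↥(maximalRealSubfield L)) L (IsCMField.complexConj L) 3 H,
            ∀ γ ∈ arithmeticLevel (↥(maximalRealSubfield L)) L (IsCMField.complexConj L) 3 H
              (K₀.1.map (MulAut.conj g).toMonoidHom), IsOfFinOrder γ → γ = 1) →
          ∃ (Sc : ComplexRecordSystem L H τ T hT K₀) (M : C5.SmallLevel K₀ ⥤ SchemeOver L)
            (_ : ∀ K : C5.SmallLevel K₀, AlgebraicGeometry.SmoothOfRelativeDimension 2 (M.obj K).hom)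
            (_ : ∀ K : C5.SmallLevel K₀, IsProjectiveOver (M.obj K))
            (e : (M ⋙ Motives.baseChangeHom τ) ≅ Sc.Mc),
            letI : Algebra L ℂ := τ.toAlgebra
            ∀ (K : C5.SmallLevel K₀) (σ : ℂ ≃ₐ[L] ℂ) (s : (FiniteAdeleRing (𝓞 L) L)ˣ),
              IsArtinCorrespondent L τ s σ.toRingEquiv →
              ∀ (v₃ : Fin 3 → L) (x : Ball), IsLinePoint L τ T v₃ x →
                ∀ d : finAdelic (↥(maximalRealSubfield L)) L (IsCMField.complexConj L) 3 H,
                  IsDiagTwist L H v₃ (recipFactor L s) d →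
                  ∀ a : finAdelic (↥(maximalRealSubfield L)) L (IsCMField.complexConj L) 3 H,
                    σ • (AlgPoints.baseChangeEquiv τ (M.obj K)).symm
                        (AlgPoints.map (e.inv.app K) ((Sc.pts K).symm (ShimuraSet.mk L H τ T hT K.1.1 x a))) =
                      (AlgPoints.baseChangeEquiv τ (M.obj K)).symm
                        (AlgPoints.map (e.inv.app K) ((Sc.pts K).symm (ShimuraSet.mk L H τ T hT K.1.1 x (d * a)))) := by
  constructor
  · intro h L _ _ _ H τ T hT hpos hanis K₀ htf
    obtain ⟨S⟩ := h L H τ T hT hpos hanis K₀ htf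
    exact ⟨S.complexRecordSystem, S.M, S.smooth, S.projective, Iso.refl _, S.descent_self⟩
  · intro h L _ _ _ H τ T hT hpos hanis K₀ htf
    obtain ⟨Sc, M, hsm, hpr, e, hrec⟩ := h L H τ T hT hpos hanis K₀ htf
    exact RecordSystem.nonempty_of_descent Sc M hsm hpr e hrec

end UnitaryCanonicalModel

end Literature.AlgebraicGeometry.ShimuraVarieties

end
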